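import Mathlib
import HarnessLib
import Literature.Analysis.ValidatedNumerics.IntervalLinearSystems

/-!
# Rump's verification theorem for dense linear systems (Acta Numerica 2010, Thm 10.6, (10.14), Thm 10.8)

Topic `Literature/Analysis/ValidatedNumerics`, namespace
`Literature.Analysis.ValidatedNumerics.RumpLinearSystem`.  Cell certnum (CERTIFIED-NUMERICS STACK,
D-0105 (6)), layer L4: the Lean soundness statement of the «verified linear solve» kernel
(`ila.solve_enclosure` over `cap.linalg.verified_solve`; INTLAB's `verifylss`, dense path).
HONEST FRAMING: this file types and PROVES the mathematical implication «inclusion test passed ⇒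
nonsingularity + enclosure»; it certifies no engine output and says nothing about how a program
establishes the hypothesis (outward-rounded interval arithmetic is the engine's business; by the
inclusion property an outward-rounded check implies the exact-arithmetic hypothesis used here).
WHAT THIS IS NOT: not a floating-point theorem; not the sparse / H-matrix path (Rump Thm 10.16 =
`Literature.Analysis.ValidatedNumerics.HullInverseBounds`); not the inner inclusion Thm 10.9.

SOURCE (read on the page): S. M. Rump, *Verification methods: rigorous results using floating-point
arithmetic*, Acta Numerica 19 (2010) 287–449 [Rump2010Verification], §10.5 «Verified solution of
dense linear systems»; held copy `paper:url-cae7890f58e7` (author's version `Ru10.pdf`), PDF pages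
81–82 (printed pp. 57–58).  Verbatim:

> **Theorem 10.6.** Let `A, R ∈ ℝⁿˣⁿ`, `b ∈ ℝⁿ` and `X ∈ 𝕀ℝⁿ` be given, and denote by `I` the
> `n × n` identity matrix. Assume `Rb + (I − RA)X ⊂ int(X)`. (10.11)  Then the matrices `A` and `R`
> are non-singular and `A⁻¹b ∈ Rb + (I − RA)X`.
> *Proof.* By Lemma 10.5 the spectral radius of `C := I − RA` is less than one. Hence the matrices
> `R` and `A` are non-singular, and the iteration `x^(k+1) := z + Cx^(k)` with `z := Rb` converges
> to `(I − C)⁻¹z = (RA)⁻¹Rb = A⁻¹b` for every starting point `x^(0) ∈ ℝⁿ`. By (10.11), `x^(k) ∈ X`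
> for any `k ≥ 0` if `x^(0) ∈ X`, and the result follows.
> […] The third improvement is that it is often better to calculate an inclusion of the difference
> of the true solution to an approximate solution `x̃`. For linear systems this is particularly
> simple, by verifying `Y := R(b − Ax̃) + (I − RA)X ⊂ int(X)` (10.14) to prove `A⁻¹b ∈ x̃ + Y`.
> **Theorem 10.8.** If Algorithm 10.7 ends successfully for a given interval matrix `𝐀 ∈ 𝕀ℝⁿˣⁿ`
> and interval right-hand side `𝐛 ∈ 𝕀ℝⁿ`, then the following is true. All matrices `A ∈ 𝐀` are
> non-singular, and the computed `XX` satisfies `Σ(𝐀, 𝐛) := {x ∈ ℝⁿ : Ax = b for some A ∈ 𝐀,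
> b ∈ 𝐛} ⊆ XX`. (10.15)  *Proof.* The proof follows by applying Theorem 10.6 to fixed but
> arbitrary `A ∈ 𝐀` and `b ∈ 𝐛` and the Inclusion property (5.16).

(Algorithm 10.7 checks `X := Z + C·Y ⊂ int(Y)` for the interval quantities `Z ∋ R(b − Ax̃)`,
`C ∋ I − RA` and returns `XX := x̃ + X`.)

## Rendering and faithfulness
* An interval vector `X ∈ 𝕀ℝⁿ` is the (nonempty) box `Set.Icc l u ⊆ (n → ℝ)`, `l ≤ u`; `int(X)` is
  its topological interior in the sup-norm (product) topology, i.e. componentwise strict inequality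
  (`mem_interior_Icc_iff`).  Printed `X ∈ 𝕀ℝⁿ` entails `X ≠ ∅`; this is the hypothesis `l ≤ u`
  (without it (10.11) would hold vacuously for an empty box and the conclusion would be false).
* For POINT data `A, R, b` the interval quantity `Rb + (I − RA)X` is rendered by its exact range
  `{Rb + (I − RA)x : x ∈ X}`; hypothesis (10.11) becomes `∀ x ∈ X, Rb + (I − RA)x ∈ int(X)`.  The
  interval evaluation a program computes (row-wise hull, then outward rounding) CONTAINS this range,
  and `⊂ int(X)` is monotone under enlargement, so a passed machine test implies the typed
  hypothesis; conversely for a point matrix the box hull of the range equals the exact interval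
  product, so nothing is lost.  Hence `thm_10_6` is Theorem 10.6 as printed (conclusion verbatim:
  `det A ≠ 0`, `det R ≠ 0`, `A⁻¹b = Rb + (I − RA)x` for some `x ∈ X`).
* Proof route: instead of Lemma 10.5 (Perron–Frobenius, `ϱ(|C|) < 1`; its printed page is illegible
  in the held copy) we use the equivalent finite argument already used for the tree's Krawczyk
  theorem (`Literature.Analysis.ValidatedNumerics.KrawczykTest_holds`, Neumaier Thm 5.1.8):
  (10.11) at two corners of `X` gives the strict weighted row-sum bound `Σ_j |C_ij| (u_j − l_j) <
  u_i − l_i` (private `rowSum_lt_width`), which yields (a) nonsingularity of `I − C = RA` by weighted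
  diagonal dominance (`det_one_sub_ne_zero`) and (b) that the algebraic fixed point `x* = A⁻¹b` of
  `x ↦ Rb + Cx` lies in `X`, by comparing `x*` with its componentwise projection onto `X`
  (`mem_Icc_of_fixedPoint`) — no limit process and no Brouwer theorem are needed.
* (10.14) is `thm_10_6_residual` (Theorem 10.6 applied to the right-hand side `b − Ax̃`);
  Theorem 10.8 is `thm_10_8` for ARBITRARY sets `𝓐`, `𝓑` of point data (interval structure is not
  needed), with the solution set `IntervalLinearSystem.solutionSet` of the tree, and the enclosure
  stated per member `A ∈ 𝓐, b ∈ 𝓑` as `x̂ ∈ x̃ + (R(b − Ax̃) + (I − RA)X)`; the machine's `XX` contains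
  every such set by the inclusion property, and `solutionSet_subset_of_test` records the coarser
  printed-shape consequence `Σ(𝓐, 𝓑) ⊆ x̃ + X`.

## Search record (TYPER LINT RULE)
`lean search` 'interior' / 'Krawczyk' / 'isUnit_of' over `Literature/Analysis/ValidatedNumerics`:
the tree has the NONLINEAR Krawczyk test (`KrawczykTest`, hypothesis `x̃ ∈ int(x)`, i.e. `0 ∈ int X`
in the present notation — Theorem 10.6 has no such hypothesis), Moore's test `K ⊆ X` plus a norm
bound (`CodeListKrawczykCert.existsUnique_zero_of_mooreTest`), the residual norm bound = Rump
Thm 10.2 (`IntervalLinearSystem.abs_sub_le_div_of_residual`) and `‖I − RA‖_∞ < 1 ⇒` nonsingular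
(`Literature.ComputerArithmetic.OishiRump2002.linfty_isUnit_det_of_norm_mul_sub_one_lt`); the
printed linear Theorems 10.6 / 10.8 were absent (certnum typed/INDEX.tsv row «Rump Thm 10.6»).

AI-produced formalisation (cell certnum, seat certnum-lean-1, 2026-08-26).
-/

set_option autoImplicit false

open Set Matrix

namespace Literature.Analysis.ValidatedNumerics.RumpLinearSystem

variable {n : Type*} [Fintype n]

/-! ## Boxes and their interior -/

/-- Membership in the interior `int(X)` of a box `X = [l, u] ⊆ ℝⁿ` (sup-norm topology) is strict
componentwise inequality. [folklore] -/
private theorem mem_interior_Icc_iff {l u y : n → ℝ} :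
    y ∈ interior (Icc l u) ↔ ∀ i, l i < y i ∧ y i < u i := by
  rw [← Set.pi_univ_Icc, interior_pi_set Set.finite_univ]
  simp only [interior_Icc, Set.mem_univ_pi, Set.mem_Ioo]

/-- Entries of a matrix–vector product: `(C x)_i = Σ_j C_ij x_j`. [folklore] -/
private theorem mulVec_apply (C : Matrix n n ℝ) (x : n → ℝ) (i : n) :
    (C *ᵥ x) i = ∑ j, C i j * x j := by
  simp [Matrix.mulVec, dotProduct]

/-! ## Step 1: the inclusion test at two corners gives strict weighted row sums -/

/-- **Corner estimate.** If `z + C x ∈ int([l, u])` for every `x` in the nonempty box `[l, u]`, then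
every weighted absolute row sum of `C` is STRICTLY below the corresponding width:
`Σ_j |C_ij| (u_j − l_j) < u_i − l_i`.  (Evaluate the hypothesis at the two corners of the box which
maximise / minimise the `i`-th component of `C x` and subtract.)  This is the finite content of
Rump's Lemma 10.5 (`ϱ(|C|) < 1`) used below. [folklore] -/
private theorem rowSum_lt_width {C : Matrix n n ℝ} {z l u : n → ℝ} (hlu : l ≤ u)
    (h : ∀ x ∈ Icc l u, z + C *ᵥ x ∈ interior (Icc l u)) (i : n) :
    ∑ j, |C i j| * (u j - l j) < u i - l i := by
  classical
  set ya : n → ℝ := fun j => if 0 ≤ C i j then u j else l j with hya_def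
  set yb : n → ℝ := fun j => if 0 ≤ C i j then l j else u j with hyb_def
  have hya : ya ∈ Icc l u := by
    refine ⟨fun j => ?_, fun j => ?_⟩ <;> simp only [hya_def] <;> split_ifs
    exacts [hlu j, le_rfl, le_rfl, hlu j]
  have hyb : yb ∈ Icc l u := by
    refine ⟨fun j => ?_, fun j => ?_⟩ <;> simp only [hyb_def] <;> split_ifs
    exacts [le_rfl, hlu j, hlu j, le_rfl]
  have ha := ((mem_interior_Icc_iff.1 (h ya hya)) i).2
  have hb := ((mem_interior_Icc_iff.1 (h yb hyb)) i).1
  simp only [Pi.add_apply] at ha hb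
  have key : (C *ᵥ ya) i - (C *ᵥ yb) i = ∑ j, |C i j| * (u j - l j) := by
    rw [mulVec_apply, mulVec_apply, ← Finset.sum_sub_distrib]
    refine Finset.sum_congr rfl fun j _ => ?_
    simp only [hya_def, hyb_def]
    split_ifs with hc
    · rw [abs_of_nonneg hc]; ring
    · rw [abs_of_neg (lt_of_not_ge hc)]; ring
  linarith

/-- Under the inclusion test every component of the box has positive width. [folklore] -/
private theorem width_pos {C : Matrix n n ℝ} {z l u : n → ℝ} (hlu : l ≤ u)
    (h : ∀ x ∈ Icc l u, z + C *ᵥ x ∈ interior (Icc l u)) (i : n) : 0 < u i - l i :=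
  lt_of_le_of_lt (Finset.sum_nonneg fun j _ => mul_nonneg (abs_nonneg _) (sub_nonneg.2 (hlu j)))
    (rowSum_lt_width hlu h i)

/-! ## Step 2: weighted strict diagonal dominance ⇒ `I − C` nonsingular -/

/-- **Weighted strict diagonal dominance.** If `d > 0` and `Σ_j |C_ij| d_j < d_i` for every row `i`,
then `I − C` is nonsingular: a kernel vector `v ≠ 0` of `I − C` satisfies `v = C v`, and at an
index maximising `|v_i| / d_i` the row bound is contradicted. [folklore] -/
private theorem det_one_sub_ne_zero [DecidableEq n] {C : Matrix n n ℝ} {d : n → ℝ} (hd : ∀ i, 0 < d i)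
    (hrow : ∀ i, ∑ j, |C i j| * d j < d i) : (1 - C).det ≠ 0 := by
  classical
  intro hdet
  obtain ⟨v, hv0, hBv⟩ := Matrix.exists_mulVec_eq_zero_iff.2 hdet
  rcases isEmpty_or_nonempty n with hn | hn
  · exact hv0 (funext fun i => (IsEmpty.false i).elim)
  obtain ⟨i₀, -, hi₀⟩ :=
    Finset.exists_max_image Finset.univ (fun i => |v i| / d i) Finset.univ_nonempty
  set m := |v i₀| / d i₀ with hm
  have hvle : ∀ j, |v j| ≤ m * d j := fun j => by
    have hj := hi₀ j (Finset.mem_univ j)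
    rwa [div_le_iff₀ (hd j)] at hj
  have hm_pos : 0 < m := by
    by_contra hle
    push Not at hle
    apply hv0
    funext j
    have h1 : |v j| ≤ 0 := by nlinarith [hvle j, hd j, abs_nonneg (v j)]
    exact abs_nonpos_iff.1 h1
  have hCv : C *ᵥ v = v := by
    have h1 : (1 - C) *ᵥ v = v - C *ᵥ v := by rw [Matrix.sub_mulVec, Matrix.one_mulVec]
    rw [h1] at hBv
    exact (sub_eq_zero.1 hBv).symm
  have key : |v i₀| < |v i₀| :=
    calc |v i₀| = |(C *ᵥ v) i₀| := by rw [hCv]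
      _ = |∑ j, C i₀ j * v j| := by rw [mulVec_apply]
      _ ≤ ∑ j, |C i₀ j * v j| := Finset.abs_sum_le_sum_abs _ _
      _ = ∑ j, |C i₀ j| * |v j| := Finset.sum_congr rfl fun j _ => abs_mul _ _
      _ ≤ ∑ j, |C i₀ j| * (m * d j) :=
        Finset.sum_le_sum fun j _ => mul_le_mul_of_nonneg_left (hvle j) (abs_nonneg _)
      _ = m * ∑ j, |C i₀ j| * d j := by
        rw [Finset.mul_sum]
        exact Finset.sum_congr rfl fun j _ => by ring
      _ < m * d i₀ := mul_lt_mul_of_pos_left (hrow i₀) hm_pos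
      _ = |v i₀| := by rw [hm]; exact div_mul_cancel₀ _ (hd i₀).ne'
  exact lt_irrefl _ key

/-! ## Step 3: the fixed point of `x ↦ z + C x` lies in the box -/

/-- **Projection argument.** Let `[l, u]` be a nonempty box mapped INTO itself by `x ↦ z + C x`, with
the strict weighted row sums of Step 1.  Then any fixed point `x* = z + C x*` lies in `[l, u]`:
otherwise compare `x*` with its componentwise projection `p` onto the box at an index `i₀`
maximising `|p_i − x*_i| / (u_i − l_i)`; there `|(z + C p)_{i₀} − x*_{i₀}| = |(C(p − x*))_{i₀}| <
|p_{i₀} − x*_{i₀}|`, contradicting `z + C p ∈ [l, u]`. [folklore] -/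
private theorem mem_Icc_of_fixedPoint {C : Matrix n n ℝ} {z l u xs : n → ℝ} (hlu : l ≤ u)
    (hinto : ∀ x ∈ Icc l u, z + C *ᵥ x ∈ Icc l u)
    (hrow : ∀ i, ∑ j, |C i j| * (u j - l j) < u i - l i)
    (hfix : z + C *ᵥ xs = xs) : xs ∈ Icc l u := by
  classical
  set d : n → ℝ := fun j => u j - l j with hd_def
  have hd : ∀ i, 0 < d i := fun i =>
    lt_of_le_of_lt (Finset.sum_nonneg fun j _ => mul_nonneg (abs_nonneg _) (sub_nonneg.2 (hlu j)))
      (hrow i)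
  -- the componentwise projection of `xs` onto the box
  set p : n → ℝ := fun j => max (l j) (min (u j) (xs j)) with hp_def
  have hp : p ∈ Icc l u :=
    ⟨fun j => le_max_left _ _, fun j => max_le (hlu j) (min_le_left _ _)⟩
  by_contra hxs
  -- some component of `xs` lies outside `[l, u]`, so `n` is nonempty
  have hne : ∃ j, p j ≠ xs j := by
    by_contra hall
    push Not at hall
    exact hxs (by rwa [show p = xs from funext hall] at hp)
  obtain ⟨j₁, hj₁⟩ := hne
  haveI : Nonempty n := ⟨j₁⟩
  obtain ⟨i₀, -, hi₀⟩ :=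
    Finset.exists_max_image Finset.univ (fun i => |p i - xs i| / d i) Finset.univ_nonempty
  set M := |p i₀ - xs i₀| / d i₀ with hM
  have hle : ∀ j, |p j - xs j| ≤ M * d j := fun j => by
    have hj := hi₀ j (Finset.mem_univ j)
    rwa [div_le_iff₀ (hd j)] at hj
  have hM_pos : 0 < M := by
    have h1 : 0 < |p j₁ - xs j₁| / d j₁ := div_pos (abs_pos.2 (sub_ne_zero.2 hj₁)) (hd j₁)
    exact lt_of_lt_of_le h1 (hi₀ j₁ (Finset.mem_univ j₁))
  have hi₀ne : p i₀ ≠ xs i₀ := by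
    intro heq
    rw [hM, heq, sub_self, abs_zero, zero_div] at hM_pos
    exact lt_irrefl _ hM_pos
  -- the image of the projection is within `|p_{i₀} − x*_{i₀}|` of `x*` in component `i₀`, strictly
  have hdiff : z + C *ᵥ p - xs = C *ᵥ (p - xs) := by
    conv_lhs => rw [← hfix]
    rw [Matrix.mulVec_sub]
    abel
  have hstrict : |(z + C *ᵥ p) i₀ - xs i₀| < |p i₀ - xs i₀| :=
    calc |(z + C *ᵥ p) i₀ - xs i₀| = |(C *ᵥ (p - xs)) i₀| := by
          rw [← Pi.sub_apply (z + C *ᵥ p) xs i₀, hdiff]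
      _ = |∑ j, C i₀ j * (p j - xs j)| := by rw [mulVec_apply]; rfl
      _ ≤ ∑ j, |C i₀ j * (p j - xs j)| := Finset.abs_sum_le_sum_abs _ _
      _ = ∑ j, |C i₀ j| * |p j - xs j| := Finset.sum_congr rfl fun j _ => abs_mul _ _
      _ ≤ ∑ j, |C i₀ j| * (M * d j) :=
        Finset.sum_le_sum fun j _ => mul_le_mul_of_nonneg_left (hle j) (abs_nonneg _)
      _ = M * ∑ j, |C i₀ j| * d j := by
        rw [Finset.mul_sum]
        exact Finset.sum_congr rfl fun j _ => by ring
      _ < M * d i₀ := mul_lt_mul_of_pos_left (hrow i₀) hM_pos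
      _ = |p i₀ - xs i₀| := by rw [hM]; exact div_mul_cancel₀ _ (hd i₀).ne'
  -- but `z + C p ∈ [l, u]` while `xs_{i₀}` is outside `[l_{i₀}, u_{i₀}]` on the side of `p_{i₀}`
  have himg := hinto p hp
  have hlo : l i₀ ≤ (z + C *ᵥ p) i₀ := himg.1 i₀
  have hhi : (z + C *ᵥ p) i₀ ≤ u i₀ := himg.2 i₀
  by_cases hup : u i₀ < xs i₀
  · -- `xs` above the box: `p i₀ = u i₀`
    have hpi : p i₀ = u i₀ := by
      simp only [hp_def, min_eq_left hup.le, max_eq_right (hlu i₀)]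
    rw [hpi, abs_of_nonpos (sub_nonpos.2 hup.le)] at hstrict
    have := (abs_lt.1 hstrict).1
    linarith
  · push Not at hup
    by_cases hdown : xs i₀ < l i₀
    · -- `xs` below the box: `p i₀ = l i₀`
      have hpi : p i₀ = l i₀ := by
        simp only [hp_def, min_eq_right hup]
        exact max_eq_left hdown.le
      rw [hpi, abs_of_nonneg (sub_nonneg.2 hdown.le)] at hstrict
      have := (abs_lt.1 hstrict).2
      linarith
    · -- `xs i₀ ∈ [l i₀, u i₀]`: the projection does not move it, contradiction with `hi₀ne`
      push Not at hdown
      exact hi₀ne (by simp only [hp_def, min_eq_right hup, max_eq_right hdown])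

/-! ## Theorem 10.6 and its residual form (10.14) -/

/-- **Rump 2010, Theorem 10.6** (verification of a dense linear system; Rump 1980, Krawczyk 1969,
Moore 1977).  Let `A, R ∈ ℝⁿˣⁿ`, `b ∈ ℝⁿ` and a nonempty interval vector `X = [l, u]` be given.  If
`Rb + (I − RA)x ∈ int(X)` for every `x ∈ X` (the exact range of the interval expression (10.11)),
then `A` and `R` are nonsingular and `A⁻¹b ∈ Rb + (I − RA)X`, i.e. `A⁻¹b = Rb + (I − RA)x` for some
`x ∈ X`.  There are no assumptions on `R` (in practice `R ≈ A⁻¹`).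
[cite: Rump2010Verification, Thm 10.6] -/
theorem thm_10_6 [DecidableEq n] (A R : Matrix n n ℝ) (b : n → ℝ) {l u : n → ℝ} (hlu : l ≤ u)
    (h : ∀ x ∈ Icc l u, R *ᵥ b + (1 - R * A) *ᵥ x ∈ interior (Icc l u)) :
    A.det ≠ 0 ∧ R.det ≠ 0 ∧ ∃ x ∈ Icc l u, A⁻¹ *ᵥ b = R *ᵥ b + (1 - R * A) *ᵥ x := by
  have hrow := rowSum_lt_width hlu h
  have hd : ∀ i, 0 < u i - l i := width_pos hlu h
  have hdetRA : (R * A).det ≠ 0 := by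
    have h1 := det_one_sub_ne_zero (C := 1 - R * A) hd hrow
    rwa [sub_sub_cancel] at h1
  have hR : R.det ≠ 0 := fun h0 => hdetRA (by rw [Matrix.det_mul, h0, zero_mul])
  have hA : A.det ≠ 0 := fun h0 => hdetRA (by rw [Matrix.det_mul, h0, mul_zero])
  refine ⟨hA, hR, A⁻¹ *ᵥ b, ?_, ?_⟩
  · -- `x* := A⁻¹ b` is the fixed point of `x ↦ Rb + (I − RA) x`; Step 3 puts it in `X`
    have hAunit : IsUnit A.det := isUnit_iff_ne_zero.2 hA
    have hfix : R *ᵥ b + (1 - R * A) *ᵥ (A⁻¹ *ᵥ b) = A⁻¹ *ᵥ b := by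
      rw [Matrix.sub_mulVec, Matrix.one_mulVec, Matrix.mulVec_mulVec, Matrix.mul_assoc,
        Matrix.mul_nonsing_inv _ hAunit, Matrix.mul_one]
      abel
    exact mem_Icc_of_fixedPoint hlu (fun x hx => interior_subset (h x hx)) hrow hfix
  · have hAunit : IsUnit A.det := isUnit_iff_ne_zero.2 hA
    rw [Matrix.sub_mulVec, Matrix.one_mulVec, Matrix.mulVec_mulVec, Matrix.mul_assoc,
      Matrix.mul_nonsing_inv _ hAunit, Matrix.mul_one]
    abel

/-- **Rump 2010, (10.14)** (Theorem 10.6 for the correction of an approximate solution `x̃`): if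
`Y := R(b − Ax̃) + (I − RA)X` satisfies `R(b − Ax̃) + (I − RA)x ∈ int(X)` for all `x ∈ X` (nonempty
box `X = [l, u]`), then `A` and `R` are nonsingular and `A⁻¹b ∈ x̃ + Y`.
[cite: Rump2010Verification, Thm 10.6] -/
theorem thm_10_6_residual [DecidableEq n] (A R : Matrix n n ℝ) (b xt : n → ℝ) {l u : n → ℝ} (hlu : l ≤ u)
    (h : ∀ x ∈ Icc l u, R *ᵥ (b - A *ᵥ xt) + (1 - R * A) *ᵥ x ∈ interior (Icc l u)) :
    A.det ≠ 0 ∧ R.det ≠ 0 ∧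
      ∃ x ∈ Icc l u, A⁻¹ *ᵥ b = xt + (R *ᵥ (b - A *ᵥ xt) + (1 - R * A) *ᵥ x) := by
  obtain ⟨hA, hR, x, hx, hsol⟩ := thm_10_6 A R (b - A *ᵥ xt) hlu h
  refine ⟨hA, hR, x, hx, ?_⟩
  have hAunit : IsUnit A.det := isUnit_iff_ne_zero.2 hA
  have h1 : A⁻¹ *ᵥ (b - A *ᵥ xt) = A⁻¹ *ᵥ b - xt := by
    rw [Matrix.mulVec_sub, Matrix.mulVec_mulVec, Matrix.nonsing_inv_mul _ hAunit,
      Matrix.one_mulVec]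
  rw [h1] at hsol
  rw [← hsol]
  abel

/-- Consequence in the coarse printed shape: under (10.14) the solution lies in `x̃ + X` (indeed in
`x̃ + int(X)`). [cite: Rump2010Verification, Thm 10.6] -/
theorem inv_mulVec_mem_add_Icc [DecidableEq n] (A R : Matrix n n ℝ) (b xt : n → ℝ) {l u : n → ℝ} (hlu : l ≤ u)
    (h : ∀ x ∈ Icc l u, R *ᵥ (b - A *ᵥ xt) + (1 - R * A) *ᵥ x ∈ interior (Icc l u)) :
    A⁻¹ *ᵥ b - xt ∈ interior (Icc l u) := by
  obtain ⟨-, -, x, hx, hsol⟩ := thm_10_6_residual A R b xt hlu h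
  rw [hsol, add_sub_cancel_left]
  exact h x hx

/-! ## Theorem 10.8: interval data -/

open Literature.Analysis.ValidatedNumerics.IntervalLinearSystem in
/-- **Rump 2010, Theorem 10.8** (interval matrix and right-hand side).  Let `𝓐` be a set of real
`n × n` matrices and `𝓑` a set of right-hand sides (the members of an interval matrix / interval
vector; any sets will do, `𝓑 ≠ ∅` as an interval vector is), `R` a point matrix, `x̃` a point vector and `X = [l, u]` a nonempty box.
If for every `A ∈ 𝓐`, `b ∈ 𝓑` and `x ∈ X` one has `R(b − Ax̃) + (I − RA)x ∈ int(X)` — which is what a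
successful run of Algorithm 10.7 (`Z + C·Y ⊂ int(Y)` in interval arithmetic) establishes, by the
inclusion property (5.16) — then all `A ∈ 𝓐` are nonsingular and every point of the solution set
`Σ(𝓐, 𝓑) = {x̂ | A x̂ = b for some A ∈ 𝓐, b ∈ 𝓑}` satisfies `x̂ = x̃ + R(b − Ax̃) + (I − RA)x` for its
data `A, b` and some `x ∈ X`; in particular `Σ(𝓐, 𝓑) ⊆ x̃ + X ⊆ XX`.
[cite: Rump2010Verification, Thm 10.8] -/
theorem thm_10_8 [DecidableEq n] {𝓐 : Set (Matrix n n ℝ)} {𝓑 : Set (n → ℝ)} (hB : 𝓑.Nonempty)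
    (R : Matrix n n ℝ) (xt : n → ℝ) {l u : n → ℝ} (hlu : l ≤ u)
    (h : ∀ A ∈ 𝓐, ∀ b ∈ 𝓑, ∀ x ∈ Icc l u,
      R *ᵥ (b - A *ᵥ xt) + (1 - R * A) *ᵥ x ∈ interior (Icc l u)) :
    (∀ A ∈ 𝓐, A.det ≠ 0) ∧
      ∀ xh ∈ solutionSet 𝓐 𝓑, ∃ A ∈ 𝓐, ∃ b ∈ 𝓑, ∃ x ∈ Icc l u,
        A *ᵥ xh = b ∧ xh = xt + (R *ᵥ (b - A *ᵥ xt) + (1 - R * A) *ᵥ x) := by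
  classical
  refine ⟨fun A hA => ?_, fun xh hxh => ?_⟩
  · obtain ⟨b, hb⟩ := hB
    exact (thm_10_6_residual A R b xt hlu (h A hA b hb)).1
  · obtain ⟨A, hA, b, hb, hAx⟩ := hxh
    obtain ⟨hAdet, -, x, hx, hsol⟩ := thm_10_6_residual A R b xt hlu (h A hA b hb)
    refine ⟨A, hA, b, hb, x, hx, hAx, ?_⟩
    have hAunit : IsUnit A.det := isUnit_iff_ne_zero.2 hAdet
    have hxh : xh = A⁻¹ *ᵥ b := by
      rw [← hAx, Matrix.mulVec_mulVec, Matrix.nonsing_inv_mul _ hAunit, Matrix.one_mulVec]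
    rw [hxh, hsol]

open Literature.Analysis.ValidatedNumerics.IntervalLinearSystem in
/-- **Theorem 10.8, printed shape** `Σ(𝓐, 𝓑) ⊆ XX`: every solution lies in `x̃ + X` (indeed in
`x̃ + int(X)`), and `XX ⊇ x̃ + X` for the machine's interval result by the inclusion property.
[cite: Rump2010Verification, Thm 10.8] -/
theorem solutionSet_subset_of_test [DecidableEq n] {𝓐 : Set (Matrix n n ℝ)} {𝓑 : Set (n → ℝ)}
    (R : Matrix n n ℝ) (xt : n → ℝ) {l u : n → ℝ} (hlu : l ≤ u)
    (h : ∀ A ∈ 𝓐, ∀ b ∈ 𝓑, ∀ x ∈ Icc l u,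
      R *ᵥ (b - A *ᵥ xt) + (1 - R * A) *ᵥ x ∈ interior (Icc l u)) :
    solutionSet 𝓐 𝓑 ⊆ (fun y => xt + y) '' interior (Icc l u) := by
  intro xh hxh
  obtain ⟨A, hA, b, hb, hAx⟩ := hxh
  obtain ⟨hAdet, -, x, hx, hsol⟩ := thm_10_6_residual A R b xt hlu (h A hA b hb)
  have hAunit : IsUnit A.det := isUnit_iff_ne_zero.2 hAdet
  have hxh' : xh = A⁻¹ *ᵥ b := by
    rw [← hAx, Matrix.mulVec_mulVec, Matrix.nonsing_inv_mul _ hAunit, Matrix.one_mulVec]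
  refine ⟨R *ᵥ (b - A *ᵥ xt) + (1 - R * A) *ᵥ x, h A hA b hb x hx, ?_⟩
  rw [hxh', hsol]

/-! ## The componentwise a-posteriori bound behind (10.8)–(10.9) (appended 2026-08-26) -/

open Literature.Analysis.ValidatedNumerics.IntervalLinearSystem in
/-- **Componentwise residual bound** (the sharper, componentwise reading of Rump's (10.8)–(10.9),
`‖A⁻¹b − x̃‖ ≤ ‖R(b − Ax̃)‖ / (1 − ‖I − RA‖)`, which the kernels actually print; a COROLLARY, not
printed in this form): if `A x* = b`, the absolute row sums of `C := I − RA` are `≤ β < 1`, and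
`‖R(b − Ax̃)‖_∞ ≤ ρ`, then for every component
`|x*_i − x̃_i| ≤ |(R(b − Ax̃))_i| + (Σ_j |C_ij|) · ρ / (1 − β)`.
Proof: `d := x* − x̃` satisfies `d = R(b − Ax̃) + C d` (the identity behind (10.8)), so
`|d_i| ≤ |(R(b − Ax̃))_i| + (Σ_j |C_ij|) ‖d‖_∞`, and `‖d‖_∞ ≤ ρ/(1 − β)` is the norm bound (10.9)
(`IntervalLinearSystem.abs_sub_le_div_of_residual`, Neumaier §4.2 (3)).  Requested by certnum-ila-1
(DESIGN-ila-solve.md §4). [cite: Rump2010Verification, Thm 10.2] -/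
theorem abs_sub_le_residual_add_rowSum_mul [DecidableEq n] {A R : Matrix n n ℝ} {b xs xt : n → ℝ}
    {β ρ : ℝ} (hA : A *ᵥ xs = b) (hE : ∀ i, absRowSum (1 - R * A) i ≤ β) (hβ : β < 1)
    (hρ : ∀ i, |(R *ᵥ (b - A *ᵥ xt)) i| ≤ ρ) (i : n) :
    |xs i - xt i| ≤ |(R *ᵥ (b - A *ᵥ xt)) i| + absRowSum (1 - R * A) i * (ρ / (1 - β)) := by
  classical
  -- the norm bound (10.9) for every component
  have hnorm : ∀ j, |xs j - xt j| ≤ ρ / (1 - β) := abs_sub_le_div_of_residual hA hE hβ hρ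
  -- the fixed-point identity `d = R r + C d`
  have hd : xs - xt = R *ᵥ (b - A *ᵥ xt) + (1 - R * A) *ᵥ (xs - xt) := by
    rw [← hA, ← Matrix.mulVec_sub, Matrix.mulVec_mulVec, Matrix.sub_mulVec, Matrix.one_mulVec]
    abel
  have hdi : xs i - xt i = (R *ᵥ (b - A *ᵥ xt)) i + ∑ j, (1 - R * A) i j * (xs j - xt j) := by
    have := congrFun hd i
    simpa [Matrix.mulVec, dotProduct] using this
  rw [hdi]
  refine (abs_add_le _ _).trans ?_
  gcongr
  calc |∑ j, (1 - R * A) i j * (xs j - xt j)| ≤ ∑ j, |(1 - R * A) i j * (xs j - xt j)| :=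
        Finset.abs_sum_le_sum_abs _ _
    _ = ∑ j, |(1 - R * A) i j| * |xs j - xt j| := Finset.sum_congr rfl fun j _ => abs_mul _ _
    _ ≤ ∑ j, |(1 - R * A) i j| * (ρ / (1 - β)) :=
        Finset.sum_le_sum fun j _ => mul_le_mul_of_nonneg_left (hnorm j) (abs_nonneg _)
    _ = absRowSum (1 - R * A) i * (ρ / (1 - β)) := by rw [← Finset.sum_mul]; rfl

end Literature.Analysis.ValidatedNumerics.RumpLinearSystem
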